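import Literature.AlgebraicGeometry.Milne1999.MumfordTateGroupMeetSpecialLefschetzGroup
import Literature.AlgebraicGeometry.HodgeTheory.DivisorLefschetzGroupCentreFiniteIntrinsic
import HarnessLib

/-!
# Milne's Theorem 4.4 on `H¹` for EVERY polarization class (hard-Lefschetz spelling, sign-free Kähler spelling, van
# Geemen's `h_K`), and the lane's `L(A)|_{H¹}` statements freed of the «Kähler multiple» hypothesis

Milne [Milne1999LefschetzClasses, Thm. 4.4, §4 p. 659]: «The map `γ ↦ (γ, γ†γ)` identifies `G(A)` with `L(A)` … the
kernel of `l(A)`, regarded as a subgroup of `GL(V(A))`, equals `S(A)`», for «any ample divisor `D` on `A`»; §1 p. 643: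
«the restriction of `†` to `C(A)` is independent of the choice of `D`».

The tree's PROVED record `Milne1999_thm44_specialLefschetzGroup_one_eq_unitaryCentralizerGroup_holds` reads the
polarization class in the KÄHLER spelling «`h` rational with `s · h` Kähler for a real `s > 0`». Its two halves
(`LefschetzGroupCentraliserInclusion.apply_one_mem_unitaryCentralizerGroup_of_eq_sum`: `⊆` from `h` rational, of type
`(1,1)`, `h^{dim A} ≠ 0`; `SpecialLefschetzGroupOneEqUnitaryCentralizer.exteriorPullbackEquiv_mem_specialLefschetzGroup`:
`⊇` from `h ∈ B¹(A) ⊗ ℂ`, `h^{dim A} ≠ 0`, `Q_h` non-degenerate) only use four properties of `h`. This file (all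
`theorem`s, no definition, no named fact) records Thm. 4.4 on `H¹` under exactly these four properties and derives it
* for every `HodgeTheory.IsPolarizationClass` (rational, supported on a divisor, HARD LEFSCHETZ — the tree's generic
  polarization notion, which André's/Voisin's `[H]` satisfies; `h^{dim A} ≠ 0` by the tree's
  `AbelianVariety.lefschetzPow_self_ne_zero_of_hasHardLefschetzProperty`, non-degeneracy by hard Lefschetz and Poincaré
  duality), answering the lane note that `∃ s > 0, IsKaehlerClass (s • h)` is not derivable from `IsPolarizationClass`;
* for the SIGN-FREE Kähler spelling (`s ≠ 0`: `-h` is as good as `h`);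
* for van Geemen's `K`-symmetrised hyperplane class `h_K = d·e^*a + φ^*e^*a` of ANY `(A, φ)` (a non-zero real multiple of
  a Kähler class, `HodgeTheory.exists_isKaehlerClass_ksymm_eq_smul`), with no sign or Kähler hypothesis;
and then restates the lane's `L(A)(ℂ)|_{H¹}` results — `L|_{H¹} = G(A) = ℂˣ · S(A)`, `S(A)`, `G(A)` independent of the
polarization, `MT|_{H¹} ⊔ S = L|_{H¹}`, and for the general (CM-)Weil member `L|_{H¹} = ℂˣ · U(φ)`, `MT|_{H¹} ⊊ L|_{H¹}`,
`MT|_{H¹} ⊔ U(φ) = L|_{H¹}` — WITHOUT the «Kähler multiple» hypothesis they carried.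

## References

* [Milne1999LefschetzClasses] J. S. Milne, *Lefschetz classes on abelian varieties*, Duke Math. J. 96 (1999), §1
  pp. 643–644, §4 p. 659 (G(A), w, l), Thm. 4.4, p. 660, Prop. 4.8.
* [VoisinHodgeI2002] C. Voisin, *Hodge Theory and Complex Algebraic Geometry I* (2002), Thm. 6.25, Rem. 6.27, §7.1.2,
  Cor. 3.9.
* [Andre1996Motifs] Y. André, *Pour une théorie inconditionnelle des motifs*, Publ. Math. IHÉS 83 (1996), §1.1 (p. 10).
* [vanGeemen1994HodgeAV] B. van Geemen, LNM 1594 (1994), Lemma 5.2, 6.9, Thm. 6.11.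
* [Milne2025AbelianMotivesCharP] J. S. Milne, *Abelian motives in characteristic p*, arXiv:2508.09972, §1.5 Ex. 1.17.
* [Deligne1982HodgeCycles] P. Deligne (notes by J. S. Milne), LNM 900 (1982), §4 (4.4) and Milne's endnote 16.
-/

noncomputable section

open CategoryTheory Polynomial
open Literature.AlgebraicTopology.SingularHomology
open Literature.AlgebraicGeometry.Motives
open Literature.AlgebraicGeometry.HodgeTheory
open Literature.AlgebraicGeometry.VanGeemen1994
open Literature.AlgebraicGeometry.Milne1999
open Literature.AlgebraicGeometry.Deligne1982
open Literature.Geometry.Kaehler (lefschetzPow)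

namespace Literature.AlgebraicGeometry.Milne1999

variable {A : AbelianVariety ℂ} {h : complexBetti A.X 2}

/-! ### §1 Thm. 4.4 on `H¹` from four properties of the class `h` -/

/-- `h^{dim A} ≠ 0` in the `cupPowTwo` spelling, from the `lefschetzPow` spelling `L_h^{dim A - 1} h ≠ 0`.
[cite: VoisinHodgeI2002, §3.1.3 Cor. 3.9] -/
theorem cupPowTwo_dim_ne_zero_of_lefschetzPow_self_ne_zero (hA : 1 ≤ A.dim)
    (htop : lefschetzPow h (A.dim - 1) 2 h ≠ 0) : cupPowTwo h A.dim ≠ 0 := by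
  have e : A.dim = (A.dim - 1) + 1 := by omega
  rw [e, cupPowTwo_succ]
  rw [HodgeRiemannDegreeOne.lefschetzPow_self_eq_cupPowTwo] at htop
  exact HodgeRiemannDegreeOne.cupProduct_ne_zero_of_degree_eq _ _ htop

variable (A) in
/-- **Milne 1999, Thm. 4.4 on `H¹` from four properties of the class**: for `h ∈ H²(A(ℂ); ℂ)` RATIONAL, of Hodge type
`(1,1)`, with `h^{dim A} ≠ 0` (`L_h^{dim A - 1} h ≠ 0`) and `Q_h = h^{dim A - 1} ⌣ (· ⌣ ·)` NON-DEGENERATE on `H¹`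
(`dim A ≥ 1`): `{g₁ | g ∈ ker l(A)(ℂ)} = S(A)(h)(ℂ) = unitaryCentralizerGroup A h`. (`⊆`: the tree's
`apply_one_mem_unitaryCentralizerGroup_of_eq_sum` — degree-two Lefschetz classes on `A × A`; `⊇`: the Künneth family
`⋀•(u^{⊕(a+1)})` fixes the divisor classes of every power, `exteriorPullbackEquiv_mem_specialLefschetzGroup`.)
[cite: Milne1999LefschetzClasses, Thm. 4.4 and §4 p. 659 (ker l(A) = S(A))] -/
theorem specialLefschetzGroup_map_one_eq_unitaryCentralizerGroup_of_nondegenerate (hA : 1 ≤ A.dim)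
    (hQ : IsRationalClass h) (h11 : IsOfHodgeType A.dim A.X 2 1 1 h) (htop : lefschetzPow h (A.dim - 1) 2 h ≠ 0)
    (hnd : ∀ x : complexBetti A.X 1, (∀ y, polarizationPairingOne A.X h (A.dim - 1) x y = 0) → x = 0) :
    (specialLefschetzGroup A.dim A.X).map
        (Pi.evalMonoidHom (fun k : ℕ ↦ complexBetti A.X k ≃ₗ[ℂ] complexBetti A.X k) 1) =
      unitaryCentralizerGroup A h := by
  have hh : h ∈ hodgeClassSpan A.dim A.X 1 := Submodule.subset_span
    (show h ∈ {c : complexBetti A.X (2 * 1) | IsRationalClass c ∧ IsOfHodgeType A.dim A.X (2 * 1) 1 1 c}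
      from ⟨hQ, h11⟩)
  refine le_antisymm ?_ fun u hu ↦ ?_
  · rintro _ ⟨g, hg, rfl⟩
    -- `h` is a combination of cup products of degree-one classes (`H² = ⋀²H¹`)
    have hmem : h ∈ Submodule.span ℂ (Set.range (cupPowOne ℂ (ComplexPoints A.X) 2)) := by
      rw [abelianVarietyCohomologyExteriorH1_holds.span_range_cupPowOne A 2]
      exact Submodule.mem_top
    obtain ⟨c, hc⟩ := (Finsupp.mem_span_range_iff_exists_finsupp.1 hmem)
    have hsum : h = ∑ l : c.support, c l • cupProduct (rfl : 1 + 1 = 2)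
        ((l : Fin 2 → complexBetti A.X 1) 0) ((l : Fin 2 → complexBetti A.X 1) 1) := by
      rw [← hc, Finsupp.sum, ← Finset.sum_coe_sort]
      refine Finset.sum_congr rfl fun l _ ↦ ?_
      rw [cupPowOne_succ, cupPowOne_one]
      rfl
    exact apply_one_mem_unitaryCentralizerGroup_of_eq_sum hA hQ h11
      (cupPowTwo_dim_ne_zero_of_lefschetzPow_self_ne_zero hA htop) _ _ _ hsum hg
  · exact Subgroup.mem_map.2 ⟨_, exteriorPullbackEquiv_mem_specialLefschetzGroup hA hh htop hnd hu,
      exteriorPullbackEquiv_one_eq _ u⟩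

/-! ### §2 Three instances: hard-Lefschetz polarization classes, the sign-free Kähler spelling, van Geemen's `h_K` -/

/-- **Milne 1999, Thm. 4.4 on `H¹` for every `IsPolarizationClass`** (rational, supported on a divisor, hard Lefschetz;
`dim A ≥ 1`): `{g₁ | g ∈ ker l(A)(ℂ)} = S(A)(h)(ℂ)`. Type `(1,1)`: algebraic classes are Hodge classes; `h^{dim A} ≠ 0` and
the non-degeneracy of `Q_h`: hard Lefschetz. [cite: Milne1999LefschetzClasses, Thm. 4.4 and §4 p. 659]
[cite: Andre1996Motifs, §1.1 (p. 10)] [cite: VoisinHodgeI2002, Thm. 6.25 and Rem. 6.27] -/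
theorem _root_.Literature.AlgebraicGeometry.HodgeTheory.IsPolarizationClass.specialLefschetzGroup_map_one_eq
    (hpol : IsPolarizationClass A.dim A.X h) (hA : 1 ≤ A.dim) :
    (specialLefschetzGroup A.dim A.X).map
        (Pi.evalMonoidHom (fun k : ℕ ↦ complexBetti A.X k ≃ₗ[ℂ] complexBetti A.X k) 1) =
      unitaryCentralizerGroup A h :=
  specialLefschetzGroup_map_one_eq_unitaryCentralizerGroup_of_nondegenerate A hA hpol.isRationalClass
    (isOfHodgeType_of_mem_algebraicClasses_of_isSmoothProjective AbelianVariety.isSmoothProjective_holds 1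
      hpol.mem_algebraicClasses)
    (AbelianVariety.lefschetzPow_self_ne_zero_of_hasHardLefschetzProperty hA hpol.hasHardLefschetz)
    fun _ hx ↦ eq_zero_of_forall_polarizationPairingOne_eq_zero_of_hasHardLefschetzProperty hA hpol.hasHardLefschetz hx

/-- **Milne 1999, Thm. 4.4 on `H¹` in the SIGN-FREE Kähler spelling**: `h` rational with `s · h` Kähler for some real
`s ≠ 0` (`dim A ≥ 1`). [cite: Milne1999LefschetzClasses, Thm. 4.4 and §4 p. 659] [cite: VoisinHodgeI2002, Thm. 6.25, §7.1.2 and Cor. 3.9] -/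
theorem specialLefschetzGroup_map_one_eq_unitaryCentralizerGroup_of_isKaehlerClass_smul (hA : 1 ≤ A.dim)
    (hQ : IsRationalClass h) {s : ℝ} (hs : s ≠ 0) (hK : IsKaehlerClass A.dim A.X ((s : ℂ) • h)) :
    (specialLefschetzGroup A.dim A.X).map
        (Pi.evalMonoidHom (fun k : ℕ ↦ complexBetti A.X k ≃ₗ[ℂ] complexBetti A.X k) 1) =
      unitaryCentralizerGroup A h := by
  have h11 : IsOfHodgeType A.dim A.X 2 1 1 h := by
    have e := (hK.isOfHodgeType_one_one).smul ((s : ℂ)⁻¹)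
    rwa [smul_smul, inv_mul_cancel₀ (Complex.ofReal_ne_zero.2 hs), one_smul] at e
  exact specialLefschetzGroup_map_one_eq_unitaryCentralizerGroup_of_nondegenerate A hA hQ h11
    (lefschetzPow_self_ne_zero_of_isKaehlerClass_smul hA hK)
    (eq_zero_of_forall_polarizationPairingOne_eq_zero_of_isKaehlerClass_smul' hs hK)

/-- **Milne 1999, Thm. 4.4 on `H¹` for van Geemen's class `h_K = d·e^*a + φ^*e^*a`** of ANY `(A, φ)` with
`dim A = m + 1`, `d ≥ 1`, `a ≠ 0` rational (no Kähler-multiple or sign hypothesis: `h_K = s · H'` with `H'` Kähler and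
`s ≠ 0` real, the tree's `exists_isKaehlerClass_ksymm_eq_smul`): `{g₁ | g ∈ ker l(A)(ℂ)} = S(A)(h_K)(ℂ)`.
[cite: Milne1999LefschetzClasses, Thm. 4.4 and §4 p. 659] [cite: vanGeemen1994HodgeAV, Lemma 5.2 (1)–(2) and 6.9] -/
theorem specialLefschetzGroup_map_one_eq_unitaryCentralizerGroup_ksymm {m d : ℕ} (hAm : A.dim = m + 1) (hd : 0 < d)
    (φ : A ⟶ A) (e : ProjectiveEmbedding A.X) {a : complexBetti (projectiveSpace e.n ℂ) 2} (ha : IsRationalClass a)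
    (ha0 : a ≠ 0) :
    (specialLefschetzGroup A.dim A.X).map
        (Pi.evalMonoidHom (fun k : ℕ ↦ complexBetti A.X k ≃ₗ[ℂ] complexBetti A.X k) 1) =
      unitaryCentralizerGroup A (hK d φ e a) := by
  obtain ⟨s, H', hs, hH', hsH⟩ := exists_isKaehlerClass_ksymm_eq_smul hAm hd φ e ha ha0
  have hK' : IsKaehlerClass A.dim A.X (((s⁻¹ : ℝ) : ℂ) • hK d φ e a) := by
    rw [hAm]
    change IsKaehlerClass (m + 1) A.X (((s⁻¹ : ℝ) : ℂ) •
      ((d : ℂ) • complexBetti.map e.ι 2 a + complexBetti.map φ.hom.hom.hom 2 (complexBetti.map e.ι 2 a)))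
    rw [hsH, smul_smul, Complex.ofReal_inv, inv_mul_cancel₀ (Complex.ofReal_ne_zero.2 hs), one_smul]
    exact hH'
  exact specialLefschetzGroup_map_one_eq_unitaryCentralizerGroup_of_isKaehlerClass_smul (by omega)
    (isRationalClass_ksymm d φ e ha) (inv_ne_zero hs) hK'

/-! ### §3 `L(A)(ℂ)|_{H¹} = G(A)(ℂ)`, independence of the polarization, `MT|_{H¹} ⊔ S = L|_{H¹}` — no Kähler hypothesis -/

/-- **`L(A)(ℂ)|_{H¹} = G(A)(ℂ)` whenever Thm. 4.4 holds on `H¹` for `h ∈ B¹(A) ⊗ ℂ`**: `L = MT ⊔ ker l` (families), so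
`L|_{H¹} = MT|_{H¹} ⊔ S(A)(h) = G(A)(h)`. [cite: Milne1999LefschetzClasses, Thm. 4.4, §4 p. 659 (L = w·ker l) and p. 660 (L(A) ⊃ Hg(A))] -/
theorem lefschetzGroup_map_one_eq_similitudeCentralizerGroup_of_eq (hh : h ∈ hodgeClassSpan A.dim A.X 1)
    (hS : (specialLefschetzGroup A.dim A.X).map
        (Pi.evalMonoidHom (fun k : ℕ ↦ complexBetti A.X k ≃ₗ[ℂ] complexBetti A.X k) 1) = unitaryCentralizerGroup A h) :
    (lefschetzGroup A.dim A.X).map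
        (Pi.evalMonoidHom (fun k : ℕ ↦ complexBetti A.X k ≃ₗ[ℂ] complexBetti A.X k) 1) =
      similitudeCentralizerGroup A h := by
  rw [← mumfordTateGroup_sup_specialLefschetzGroup_eq_lefschetzGroup (AbelianVariety.isSmoothProjective_holds (A := A)),
    Subgroup.map_sup, hS, map_mumfordTateGroup_sup_unitaryCentralizerGroup_eq_similitudeCentralizerGroup hh]

/-- **Milne 1999, Thm. 4.4 on `H¹` for `L(A)` and every `IsPolarizationClass`**: `{g₁ | g ∈ L(A)(ℂ)} = G(A)(h)(ℂ)`
(`dim A ≥ 1`). [cite: Milne1999LefschetzClasses, Thm. 4.4 and §4 p. 659] [cite: Andre1996Motifs, §1.1 (p. 10)] -/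
theorem _root_.Literature.AlgebraicGeometry.HodgeTheory.IsPolarizationClass.lefschetzGroup_map_one_eq
    (hpol : IsPolarizationClass A.dim A.X h) (hA : 1 ≤ A.dim) :
    (lefschetzGroup A.dim A.X).map
        (Pi.evalMonoidHom (fun k : ℕ ↦ complexBetti A.X k ≃ₗ[ℂ] complexBetti A.X k) 1) =
      similitudeCentralizerGroup A h :=
  lefschetzGroup_map_one_eq_similitudeCentralizerGroup_of_eq hpol.mem_hodgeClassSpan_one
    (hpol.specialLefschetzGroup_map_one_eq hA)

/-- **`{g₁ | g ∈ L(A)(ℂ)} = ℂˣ · S(A)(h)(ℂ)` for every `IsPolarizationClass`** (`dim A ≥ 1`).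
[cite: Milne1999LefschetzClasses, Thm. 4.4 and §4 p. 659] -/
theorem _root_.Literature.AlgebraicGeometry.HodgeTheory.IsPolarizationClass.mem_map_lefschetzGroup_one_iff
    (hpol : IsPolarizationClass A.dim A.X h) (hA : 1 ≤ A.dim) {u : complexBetti A.X 1 ≃ₗ[ℂ] complexBetti A.X 1} :
    u ∈ (lefschetzGroup A.dim A.X).map
        (Pi.evalMonoidHom (fun k : ℕ ↦ complexBetti A.X k ≃ₗ[ℂ] complexBetti A.X k) 1) ↔
      ∃ c : ℂˣ, ∃ u' ∈ unitaryCentralizerGroup A h, u = LinearEquiv.smulOfUnit c * u' := by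
  rw [hpol.lefschetzGroup_map_one_eq hA, mem_similitudeCentralizerGroup_iff_exists_smulOfUnit_mul]

/-- `S(A)(h)(ℂ) ≤ {g₁ | g ∈ L(A)(ℂ)}` for every `IsPolarizationClass` (`dim A ≥ 1`). [cite: Milne1999LefschetzClasses, Thm. 4.4 and §4 p. 659] -/
theorem _root_.Literature.AlgebraicGeometry.HodgeTheory.IsPolarizationClass.unitaryCentralizerGroup_le_lefschetzGroup_map_one
    (hpol : IsPolarizationClass A.dim A.X h) (hA : 1 ≤ A.dim) :
    unitaryCentralizerGroup A h ≤ (lefschetzGroup A.dim A.X).map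
        (Pi.evalMonoidHom (fun k : ℕ ↦ complexBetti A.X k ≃ₗ[ℂ] complexBetti A.X k) 1) := by
  rw [hpol.lefschetzGroup_map_one_eq hA]
  exact unitaryCentralizerGroup_le_similitudeCentralizerGroup

/-- **`S(A)(ℂ)` does not depend on the polarization class** (§1 p. 643), for any two `IsPolarizationClass`es
(`dim A ≥ 1`). [cite: Milne1999LefschetzClasses, §1 pp. 643–644 and Thm. 4.4] -/
theorem unitaryCentralizerGroup_eq_of_isPolarizationClass {h' : complexBetti A.X 2} (hpol : IsPolarizationClass A.dim A.X h)
    (hpol' : IsPolarizationClass A.dim A.X h') (hA : 1 ≤ A.dim) :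
    unitaryCentralizerGroup A h = unitaryCentralizerGroup A h' := by
  rw [← hpol.specialLefschetzGroup_map_one_eq hA, ← hpol'.specialLefschetzGroup_map_one_eq hA]

/-- **`G(A)(ℂ)` does not depend on the polarization class** (§4 p. 659: «for any ample divisor `D`»), for any two
`IsPolarizationClass`es (`dim A ≥ 1`). [cite: Milne1999LefschetzClasses, §4 p. 659 and §1 p. 643] -/
theorem similitudeCentralizerGroup_eq_of_isPolarizationClass {h' : complexBetti A.X 2}
    (hpol : IsPolarizationClass A.dim A.X h) (hpol' : IsPolarizationClass A.dim A.X h') (hA : 1 ≤ A.dim) :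
    similitudeCentralizerGroup A h = similitudeCentralizerGroup A h' := by
  rw [← hpol.lefschetzGroup_map_one_eq hA, ← hpol'.lefschetzGroup_map_one_eq hA]

/-- `S(A)(h_K)(ℂ) = S(A)(h)(ℂ)`: van Geemen's class and any `IsPolarizationClass` define the same group (`dim A = m + 1`).
[cite: Milne1999LefschetzClasses, §1 pp. 643–644 and Thm. 4.4] [cite: vanGeemen1994HodgeAV, Lemma 5.2 and 6.9] -/
theorem unitaryCentralizerGroup_ksymm_eq_of_isPolarizationClass {m d : ℕ} (hAm : A.dim = m + 1) (hd : 0 < d)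
    (φ : A ⟶ A) (e : ProjectiveEmbedding A.X) {a : complexBetti (projectiveSpace e.n ℂ) 2} (ha : IsRationalClass a)
    (ha0 : a ≠ 0) (hpol : IsPolarizationClass A.dim A.X h) :
    unitaryCentralizerGroup A (hK d φ e a) = unitaryCentralizerGroup A h := by
  rw [← specialLefschetzGroup_map_one_eq_unitaryCentralizerGroup_ksymm hAm hd φ e ha ha0,
    hpol.specialLefschetzGroup_map_one_eq (by omega)]

/-- **`L(A)(ℂ)|_{H¹} = G(A)(h_K)(ℂ)` for van Geemen's class `h_K`** of any `(A, φ)` (`dim A = m + 1`, `d ≥ 1`, `a ≠ 0`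
rational) — the «Kähler multiple of `h_K`» hypothesis of the lane's earlier statements is superfluous.
[cite: Milne1999LefschetzClasses, Thm. 4.4 and §4 p. 659] [cite: vanGeemen1994HodgeAV, Lemma 5.2 (1)–(2) and 6.9] -/
theorem lefschetzGroup_map_one_eq_similitudeCentralizerGroup_ksymm {m d : ℕ} (hAm : A.dim = m + 1) (hd : 0 < d)
    (φ : A ⟶ A) (e : ProjectiveEmbedding A.X) {a : complexBetti (projectiveSpace e.n ℂ) 2} (ha : IsRationalClass a)
    (ha0 : a ≠ 0) :
    (lefschetzGroup A.dim A.X).map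
        (Pi.evalMonoidHom (fun k : ℕ ↦ complexBetti A.X k ≃ₗ[ℂ] complexBetti A.X k) 1) =
      similitudeCentralizerGroup A (hK d φ e a) := by
  refine lefschetzGroup_map_one_eq_similitudeCentralizerGroup_of_eq (Submodule.subset_span ⟨isRationalClass_ksymm d φ e ha, ?_⟩)
    (specialLefschetzGroup_map_one_eq_unitaryCentralizerGroup_ksymm hAm hd φ e ha ha0)
  have h11 := isOfHodgeType_one_one_ksymm hAm hd φ e ha ha0
  rw [← hAm] at h11
  exact h11

/-- **`MT(A)(ℂ)|_{H¹} ⊔ S(A)(h)(ℂ) = L(A)(ℂ)|_{H¹}` for every `IsPolarizationClass`** (`dim A ≥ 1`; no Kähler hypothesis).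
[cite: Milne1999LefschetzClasses, Thm. 4.4, §4 p. 659 (L = w·ker l) and p. 660] -/
theorem _root_.Literature.AlgebraicGeometry.HodgeTheory.IsPolarizationClass.map_mumfordTateGroup_sup_unitaryCentralizerGroup_eq
    (hpol : IsPolarizationClass A.dim A.X h) (hA : 1 ≤ A.dim) :
    (mumfordTateGroup A.dim A.X).map
        (Pi.evalMonoidHom (fun k : ℕ ↦ complexBetti A.X k ≃ₗ[ℂ] complexBetti A.X k) 1) ⊔
        unitaryCentralizerGroup A h =
      (lefschetzGroup A.dim A.X).map
        (Pi.evalMonoidHom (fun k : ℕ ↦ complexBetti A.X k ≃ₗ[ℂ] complexBetti A.X k) 1) := by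
  rw [hpol.lefschetzGroup_map_one_eq hA]
  exact map_mumfordTateGroup_sup_unitaryCentralizerGroup_eq_similitudeCentralizerGroup hpol.mem_hodgeClassSpan_one

/-- **`MT(A)(ℂ)|_{H¹} ⊊ L(A)(ℂ)|_{H¹} ⟺ Hg(A)(ℂ)|_{H¹} ≠ S(A)(h)(ℂ)`** for every `IsPolarizationClass` (`dim A ≥ 1`): Prop. 4.8
(b) ⟺ (c) on `H¹`, through the square of `MumfordTateGroupMeetSpecialLefschetzGroup`.
[cite: Milne1999LefschetzClasses, Prop. 4.8 (p. 660) and Thm. 4.4] -/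
theorem _root_.Literature.AlgebraicGeometry.HodgeTheory.IsPolarizationClass.map_mumfordTateGroup_one_lt_map_lefschetzGroup_one_iff
    (hpol : IsPolarizationClass A.dim A.X h) (hA : 1 ≤ A.dim) :
    (mumfordTateGroup A.dim A.X).map
        (Pi.evalMonoidHom (fun k : ℕ ↦ complexBetti A.X k ≃ₗ[ℂ] complexBetti A.X k) 1) <
      (lefschetzGroup A.dim A.X).map
        (Pi.evalMonoidHom (fun k : ℕ ↦ complexBetti A.X k ≃ₗ[ℂ] complexBetti A.X k) 1) ↔
      hodgeGroupOne A.dim A.X ≠ unitaryCentralizerGroup A h := by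
  rw [hpol.lefschetzGroup_map_one_eq hA, lt_iff_le_and_ne, ne_eq, map_mumfordTateGroup_eq_similitudeCentralizerGroup_iff hpol hA,
    and_iff_right (mumfordTateGroup_map_one_le_similitudeCentralizerGroup hpol.mem_hodgeClassSpan_one)]

end Literature.AlgebraicGeometry.Milne1999

/-! ### §4 The general CM-Weil member: `L(A)(ℂ)|_{H¹} = ℂˣ · U(φ)(ℂ)`, `MT|_{H¹} ⊊ L|_{H¹}`, `MT|_{H¹} ⊔ U(φ) = L|_{H¹}` — no Kähler hypothesis -/

namespace Literature.AlgebraicGeometry.Deligne1982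

section CM

variable {A : AbelianVariety ℂ} {η : A ⟶ A} {R : Polynomial ℤ} {e₀ k : ℕ} {h : complexBetti A.X 2}
  (hW : IsWeilTypeCM A η R e₀ k) (hpol : IsPolarizationClass A.dim A.X h) (hRos : IsRosatiCM A η h)

include hW hpol hRos in
/-- **`L(A)(ℂ)|_{H¹} = ℂˣ · U(φ)(ℂ)` for the general CM-Weil abelian variety** (`Hg(A) = SU(φ)`, `k ≥ 2`), for the
polarization class `h` itself (no Kähler-multiple hypothesis). [cite: Milne2025AbelianMotivesCharP, §1.5 Example 1.17]
[cite: Milne1999LefschetzClasses, Thm. 4.4 and §4 p. 659] -/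
theorem IsWeilTypeCM.mem_map_lefschetzGroup_one_iff_of_hodgeGroupSU' (hk : 2 ≤ k)
    (hSU : HasHodgeGroupSUCM A η (R.comp (X ^ 2)) h) {u : complexBetti A.X 1 ≃ₗ[ℂ] complexBetti A.X 1} :
    u ∈ (lefschetzGroup A.dim A.X).map
        (Pi.evalMonoidHom (fun k : ℕ ↦ complexBetti A.X k ≃ₗ[ℂ] complexBetti A.X k) 1) ↔
      ∃ c : ℂˣ, ∃ u' ∈ weilUnitaryGroupCM A η h, u = LinearEquiv.smulOfUnit c * u' := by
  have hA : 1 ≤ A.dim := by have := hW.two_le_dim; omega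
  rw [hpol.mem_map_lefschetzGroup_one_iff hA, hW.unitaryCentralizerGroup_eq_weilUnitaryGroupCM_of_hodgeGroupSU hpol hRos hk hSU]

include hW hpol hRos in
/-- `U(φ)(ℂ) ≤ L(A)(ℂ)|_{H¹}` for the general CM-Weil member (`k ≥ 2`; no Kähler hypothesis).
[cite: Milne1999LefschetzClasses, Thm. 4.4] [cite: Milne2025AbelianMotivesCharP, §1.5 Example 1.17] -/
theorem IsWeilTypeCM.weilUnitaryGroupCM_le_lefschetzGroup_map_one_of_hodgeGroupSU' (hk : 2 ≤ k)
    (hSU : HasHodgeGroupSUCM A η (R.comp (X ^ 2)) h) :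
    weilUnitaryGroupCM A η h ≤ (lefschetzGroup A.dim A.X).map
      (Pi.evalMonoidHom (fun k : ℕ ↦ complexBetti A.X k ≃ₗ[ℂ] complexBetti A.X k) 1) := by
  have hA : 1 ≤ A.dim := by have := hW.two_le_dim; omega
  rw [← hW.unitaryCentralizerGroup_eq_weilUnitaryGroupCM_of_hodgeGroupSU hpol hRos hk hSU]
  exact hpol.unitaryCentralizerGroup_le_lefschetzGroup_map_one hA

include hW hpol hRos in
/-- **`MT(A)(ℂ)|_{H¹} ⊊ L(A)(ℂ)|_{H¹}` for the general CM-Weil abelian variety** (`k ≥ 2`; no Kähler hypothesis: Milne's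
`Hg(A) ≠ L(A)` persists on `H¹` for the polarization class itself). [cite: Milne2025AbelianMotivesCharP, §1.5 Example 1.17]
[cite: Milne1999LefschetzClasses, Thm. 4.4, p. 660 and Prop. 4.8] -/
theorem IsWeilTypeCM.map_mumfordTateGroup_one_lt_map_lefschetzGroup_one_of_hodgeGroupSU' (hk : 2 ≤ k)
    (hSU : HasHodgeGroupSUCM A η (R.comp (X ^ 2)) h) :
    (mumfordTateGroup A.dim A.X).map
        (Pi.evalMonoidHom (fun k : ℕ ↦ complexBetti A.X k ≃ₗ[ℂ] complexBetti A.X k) 1) <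
      (lefschetzGroup A.dim A.X).map
        (Pi.evalMonoidHom (fun k : ℕ ↦ complexBetti A.X k ≃ₗ[ℂ] complexBetti A.X k) 1) := by
  have hA : 1 ≤ A.dim := by have := hW.two_le_dim; omega
  rw [hpol.lefschetzGroup_map_one_eq hA]
  exact hW.map_mumfordTateGroup_one_lt_similitudeCentralizerGroup_of_hodgeGroupSU hpol hRos hk hSU

include hW hpol hRos in
/-- **`MT(A)(ℂ)|_{H¹} ⊔ U(φ)(ℂ) = L(A)(ℂ)|_{H¹}` for the general CM-Weil abelian variety** (`k ≥ 2`; no Kähler hypothesis).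
[cite: Milne2025AbelianMotivesCharP, §1.5 Example 1.17] [cite: Milne1999LefschetzClasses, Thm. 4.4 and §4 p. 659] -/
theorem IsWeilTypeCM.map_mumfordTateGroup_sup_weilUnitaryGroupCM_eq_lefschetzGroup_map_one_of_hodgeGroupSU' (hk : 2 ≤ k)
    (hSU : HasHodgeGroupSUCM A η (R.comp (X ^ 2)) h) :
    (mumfordTateGroup A.dim A.X).map
        (Pi.evalMonoidHom (fun k : ℕ ↦ complexBetti A.X k ≃ₗ[ℂ] complexBetti A.X k) 1) ⊔ weilUnitaryGroupCM A η h =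
      (lefschetzGroup A.dim A.X).map
        (Pi.evalMonoidHom (fun k : ℕ ↦ complexBetti A.X k ≃ₗ[ℂ] complexBetti A.X k) 1) := by
  have hA : 1 ≤ A.dim := by have := hW.two_le_dim; omega
  rw [hpol.lefschetzGroup_map_one_eq hA]
  exact hW.map_mumfordTateGroup_sup_weilUnitaryGroupCM_eq_similitudeCentralizerGroup_of_hodgeGroupSU hpol hRos hk hSU

end CM

end Literature.AlgebraicGeometry.Deligne1982

/-! ### §5 Van Geemen's general member (`K = ℚ(√-d)`): the same for `h_K`, with no Kähler hypothesis -/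

namespace Literature.AlgebraicGeometry.VanGeemen1994

section Package

variable (A : AbelianVariety ℂ) (φ : A ⟶ A) (n d : ℕ) (e : ProjectiveEmbedding A.X)
  (a : complexBetti (projectiveSpace e.n ℂ) 2)

/-- **`L(A)(ℂ)|_{H¹} = ℂˣ · U_H(ℂ)` for van Geemen's general Weil-type abelian variety** (`Hg = SU_H`, `n ≥ 2`), with
`U_H = U_{h_K}` and no Kähler hypothesis on `h_K`. [cite: Milne1999LefschetzClasses, Thm. 4.4 and §4 p. 659]
[cite: vanGeemen1994HodgeAV, 6.9 and Thm. 6.11] -/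
theorem mem_map_lefschetzGroup_one_iff_of_hasHodgeGroupSU_ksymm (hn : 2 ≤ n) (hd : 0 < d) (hA : A.dim = 2 * n)
    (hφ : φ ≫ φ = -(d • 𝟙 A)) (ha : IsRationalClass a) (ha0 : a ≠ 0) (hSU : HasHodgeGroupSU A φ n d (hK d φ e a))
    {u : complexBetti A.X 1 ≃ₗ[ℂ] complexBetti A.X 1} :
    u ∈ (lefschetzGroup A.dim A.X).map
        (Pi.evalMonoidHom (fun k : ℕ ↦ complexBetti A.X k ≃ₗ[ℂ] complexBetti A.X k) 1) ↔
      ∃ c : ℂˣ, ∃ u' ∈ weilUnitaryGroup A φ n (hK d φ e a), u = LinearEquiv.smulOfUnit c * u' := by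
  rw [lefschetzGroup_map_one_eq_similitudeCentralizerGroup_ksymm (m := 2 * n - 1) (by omega) hd φ e ha ha0,
    mem_similitudeCentralizerGroup_iff_of_hasHodgeGroupSU A φ n d e a hn hd hA hφ ha ha0 hSU]

/-- **`U_H(ℂ) ≤ L(A)(ℂ)|_{H¹}` for van Geemen's general member** (`n ≥ 2`; no Kähler hypothesis).
[cite: Milne1999LefschetzClasses, Thm. 4.4] [cite: vanGeemen1994HodgeAV, 6.9 and Thm. 6.11] -/
theorem weilUnitaryGroup_le_lefschetzGroup_map_one_of_hasHodgeGroupSU (hn : 2 ≤ n) (hd : 0 < d) (hA : A.dim = 2 * n)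
    (hφ : φ ≫ φ = -(d • 𝟙 A)) (ha : IsRationalClass a) (ha0 : a ≠ 0) (hSU : HasHodgeGroupSU A φ n d (hK d φ e a)) :
    weilUnitaryGroup A φ n (hK d φ e a) ≤ (lefschetzGroup A.dim A.X).map
      (Pi.evalMonoidHom (fun k : ℕ ↦ complexBetti A.X k ≃ₗ[ℂ] complexBetti A.X k) 1) := by
  rw [lefschetzGroup_map_one_eq_similitudeCentralizerGroup_ksymm (m := 2 * n - 1) (by omega) hd φ e ha ha0,
    ← unitaryCentralizerGroup_eq_weilUnitaryGroup_of_hasHodgeGroupSU A φ n d e a hn hd hA hφ ha ha0 hSU]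
  exact unitaryCentralizerGroup_le_similitudeCentralizerGroup

/-- **`MT(A)(ℂ)|_{H¹} ⊊ L(A)(ℂ)|_{H¹}` for van Geemen's general Weil-type abelian variety** (`n ≥ 2`), WITHOUT the
Kähler-multiple hypothesis of the lane's `map_mumfordTateGroup_one_lt_map_lefschetzGroup_one_of_hasHodgeGroupSU`.
[cite: Milne2025AbelianMotivesCharP, §1.5 Example 1.17] [cite: Milne1999LefschetzClasses, Thm. 4.4, p. 660 and Prop. 4.8]
[cite: vanGeemen1994HodgeAV, Thm. 6.11] -/
theorem map_mumfordTateGroup_one_lt_map_lefschetzGroup_one_of_hasHodgeGroupSU_ksymm (hn : 2 ≤ n) (hd : 0 < d)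
    (hA : A.dim = 2 * n) (hφ : φ ≫ φ = -(d • 𝟙 A)) (ha : IsRationalClass a) (ha0 : a ≠ 0)
    (hSU : HasHodgeGroupSU A φ n d (hK d φ e a)) :
    (mumfordTateGroup A.dim A.X).map
        (Pi.evalMonoidHom (fun k : ℕ ↦ complexBetti A.X k ≃ₗ[ℂ] complexBetti A.X k) 1) <
      (lefschetzGroup A.dim A.X).map
        (Pi.evalMonoidHom (fun k : ℕ ↦ complexBetti A.X k ≃ₗ[ℂ] complexBetti A.X k) 1) := by
  rw [lefschetzGroup_map_one_eq_similitudeCentralizerGroup_ksymm (m := 2 * n - 1) (by omega) hd φ e ha ha0]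
  exact map_mumfordTateGroup_one_lt_similitudeCentralizerGroup_of_hasHodgeGroupSU A φ n d e a hn hd hA hφ ha ha0 hSU

/-- **`MT(A)(ℂ)|_{H¹} ⊔ U_H(ℂ) = L(A)(ℂ)|_{H¹}` for van Geemen's general member** (`n ≥ 2`; no Kähler hypothesis).
[cite: Milne2025AbelianMotivesCharP, §1.5 Example 1.17] [cite: Milne1999LefschetzClasses, Thm. 4.4 and §4 p. 659] -/
theorem map_mumfordTateGroup_sup_weilUnitaryGroup_eq_lefschetzGroup_map_one_of_hasHodgeGroupSU_ksymm (hn : 2 ≤ n)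
    (hd : 0 < d) (hA : A.dim = 2 * n) (hφ : φ ≫ φ = -(d • 𝟙 A)) (ha : IsRationalClass a) (ha0 : a ≠ 0)
    (hSU : HasHodgeGroupSU A φ n d (hK d φ e a)) :
    (mumfordTateGroup A.dim A.X).map
        (Pi.evalMonoidHom (fun k : ℕ ↦ complexBetti A.X k ≃ₗ[ℂ] complexBetti A.X k) 1) ⊔
        weilUnitaryGroup A φ n (hK d φ e a) =
      (lefschetzGroup A.dim A.X).map
        (Pi.evalMonoidHom (fun k : ℕ ↦ complexBetti A.X k ≃ₗ[ℂ] complexBetti A.X k) 1) := by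
  rw [lefschetzGroup_map_one_eq_similitudeCentralizerGroup_ksymm (m := 2 * n - 1) (by omega) hd φ e ha ha0]
  exact map_mumfordTateGroup_sup_weilUnitaryGroup_eq_similitudeCentralizerGroup_of_hasHodgeGroupSU A φ n d e a hn hd hA
    hφ ha ha0 hSU

/-- **`S(A)(h_K)(ℂ) ≤ L(A)(ℂ)|_{H¹}` and `Hg(A)(ℂ)|_{H¹} ⊊ L(A)(ℂ)|_{H¹}`-type corollary: `U_H(ℂ) ⊄ MT|_{H¹}` but
`U_H(ℂ) ≤ L|_{H¹}`** — the exotic (Weil) classes on the powers of the general member, seen on `H¹` with no Kähler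
hypothesis: `L(A)(ℂ)|_{H¹} ⊄ MT(A)(ℂ)|_{H¹}`. [cite: Milne1999LefschetzClasses, Prop. 4.8 (p. 660)] [cite: vanGeemen1994HodgeAV, Thm. 6.11–6.12] -/
theorem not_map_lefschetzGroup_one_le_map_mumfordTateGroup_one_of_hasHodgeGroupSU (hn : 2 ≤ n) (hd : 0 < d)
    (hA : A.dim = 2 * n) (hφ : φ ≫ φ = -(d • 𝟙 A)) (ha : IsRationalClass a) (ha0 : a ≠ 0)
    (hSU : HasHodgeGroupSU A φ n d (hK d φ e a)) :
    ¬ (lefschetzGroup A.dim A.X).map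
        (Pi.evalMonoidHom (fun k : ℕ ↦ complexBetti A.X k ≃ₗ[ℂ] complexBetti A.X k) 1) ≤
      (mumfordTateGroup A.dim A.X).map
        (Pi.evalMonoidHom (fun k : ℕ ↦ complexBetti A.X k ≃ₗ[ℂ] complexBetti A.X k) 1) :=
  fun hle ↦ not_weilUnitaryGroup_le_map_mumfordTateGroup A φ n d e a hn hd hA hφ
    (fun _ hc ↦ isOfHodgeType_of_mem_weilClassesOf_of_hasHodgeGroupSU hd hA hφ hSU hc) ha ha0
    ((weilUnitaryGroup_le_lefschetzGroup_map_one_of_hasHodgeGroupSU A φ n d e a hn hd hA hφ ha ha0 hSU).trans hle)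

end Package

end Literature.AlgebraicGeometry.VanGeemen1994

end
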